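import Summits.Ventures.CertifiedManyBodySolver.Observables.NeelClassFloorOneBody
import Literature.MathematicalPhysics.QuantumLattice.HubbardGroundStateLatticeCovariance
import HarnessLib

/-!
# Ventures/CertifiedManyBodySolver — Observables/NeelClassFloorTraces.lean

HONEST FRAMING: first certified bounds; not a superconductivity verdict; every number certified or labelled float.
A competing-order EXCLUSION removes a named class of candidate ground states; it never says which order is present;
no phase sentence follows.

Cell `hubbard-tc` (MO-S3, D-0096), seat `hubbard-tc-mod-3` (G3: competing orders — stripe/CDW/AF — as EXCLUSION
inputs from certified energy ORDERINGS), `prover-hubbard-tc-mod-3-g7-0`. The AF item of the seat's row: the KERNEL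
device behind the G3 words «Néel (antiferromagnetic) mean-field class excluded» (`NeelClassExclusion*.lean`).
Family `hubbard`; namespace `Summit.Ventures.CertifiedManyBodySolver.Observables.NeelClassFloor`.

Part 2 of 3 of the SDW-reference kinetic floor (`NeelClassKineticFloor.lean`):
* §3 traces — the two spin species together fill both SDW bands once: `P_+ + P_- = 1 - K R`,
  `tr(E(P_+ + P_-)) = tr E`, `tr(K'(P_+ + P_-)) = 0` (`tr(K' K R) = 0` by the staggering symmetry), `Σ_k ε_k² = tr K² = 4t²L²`
  (each site has four neighbours) and `tr E = Σ_k E_k ≤ L²√(4t² + Δ²)` (Cauchy–Schwarz);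
* §4 three one-body inequalities on Fock space for ONE spin species `dΓ_σ`: `dΓ_σ(C) ⪰ 0` and `dΓ_σ(C) ≤ tr C` for
  `C ⪰ 0`, `dΓ_σ(P) ≤ N̂_σ` for `P ≤ 1` (spectral expansion of `dΓ_σ`, each rotated occupation in `[0, ‖φ‖²]`);
* §4b `|Re⟨φ, Ôφ⟩| ≤ Re⟨φ, N̂φ⟩` for `Ô = dΓ_↑(S) - dΓ_↓(S)` (twice the staggered magnetisation), i.e. `2|m| ≤ n`.
Everything is PROVED; no definition, no named fact, no `sorry`.

## References

* E. H. Lieb, M. Loss, Duke Math. J. 71 (1993) 337, §8, Theorem 8.2 (sum of negative eigenvalues bounds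
  `dΓ`; bathtub). [LiebLoss1993]
* J. S. Langer, D. C. Mattis, Phys. Lett. 36A (1971) 139, eqs. (2)–(3) (the two-sublattice one-body
  Hamiltonian `K ± ΔS`, bands `±√(ε² + Δ²)`). [LangerMattis1971]
* V. Bach, E. H. Lieb, J. P. Solovej, J. Stat. Phys. 76 (1994) 3, §2 eq. (2c.36) (quasi-free states: Wick's
  rule `⟨n↑n↓⟩ = ⟨n↑⟩⟨n↓⟩` for collinear Slater determinants). [BachLiebSolovej1994]
* H. Xu et al., Science 384 (2024) eadh7691, eq. (1) (the `t–t'` Hubbard model, `t' < 0`). [XuEtAl2024]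
-/

noncomputable section

namespace Summit.Ventures.CertifiedManyBodySolver.Observables

namespace NeelClassFloor

open Literature.MathematicalPhysics.QuantumLattice

open Matrix Finset Literature.Probability.LatticeModels
  Literature.MathematicalPhysics.QuantumLattice.RayleighBound
  Literature.MathematicalPhysics.QuantumLattice.HubbardBandBottom
  Literature.MathematicalPhysics.QuantumLattice.LangerMattis
  Literature.MathematicalPhysics.QuantumLattice.HartreeFock
  Literature.MathematicalPhysics.QuantumLattice.TTPrimeFree
  Literature.MathematicalPhysics.QuantumLattice.FreeKinetic
open scoped ComplexOrder ComplexConjugate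

variable {L : ℕ}

/-! ### §3 Traces: both SDW bands filled once; `tr E ≤ L²√(4t² + Δ²)` -/

section Traces

variable [NeZero L]

/-- `P_+ + P_- = 1 - K R`. [cite: LangerMattis1971, eq. (2)] -/
theorem sdwProj_add_sdwProj (t Δ : ℝ) :
    sdwProj 2 L t Δ 1 + sdwProj 2 L t Δ (-1) = 1 - hopMatrix (fermionTorusGraph 2 L) t * sdwR 2 L t Δ := by
  rw [sdwProj, sdwProj, sdwH, sdwH, ← smul_add, Matrix.add_mul, Matrix.add_mul, Matrix.smul_mul,
    Matrix.smul_mul]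
  ext i j
  simp only [Matrix.smul_apply, Matrix.add_apply, Matrix.sub_apply, smul_eq_mul]
  push_cast
  ring

/-- `tr (E (P_+ + P_-)) = tr E` (`E K R = K`, `tr K = 0`). [folklore] -/
theorem trace_sdwE_matrix_mul_sdwProj_add (hL : 3 ≤ L) (t : ℝ) {Δ : ℝ} (hΔ : Δ ≠ 0) :
    (sdwM 2 L t Δ * sdwR 2 L t Δ * (sdwProj 2 L t Δ 1 + sdwProj 2 L t Δ (-1))).trace =
      (sdwM 2 L t Δ * sdwR 2 L t Δ).trace := by
  rw [sdwProj_add_sdwProj, Matrix.mul_sub, Matrix.mul_one, trace_sub]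
  have h : sdwM 2 L t Δ * sdwR 2 L t Δ * (hopMatrix (fermionTorusGraph 2 L) t * sdwR 2 L t Δ) =
      hopMatrix (fermionTorusGraph 2 L) t := by
    have hKR : hopMatrix (fermionTorusGraph 2 L) t * sdwR 2 L t Δ = sdwR 2 L t Δ * hopMatrix (fermionTorusGraph 2 L) t :=
      (sdwR_mul_hopMatrix hL t Δ).symm
    calc sdwM 2 L t Δ * sdwR 2 L t Δ * (hopMatrix (fermionTorusGraph 2 L) t * sdwR 2 L t Δ)
        = sdwM 2 L t Δ * sdwR 2 L t Δ * (sdwR 2 L t Δ * hopMatrix (fermionTorusGraph 2 L) t) := by rw [hKR]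
      _ = (sdwM 2 L t Δ * sdwR 2 L t Δ * sdwR 2 L t Δ) * hopMatrix (fermionTorusGraph 2 L) t := by
          simp only [Matrix.mul_assoc]
      _ = hopMatrix (fermionTorusGraph 2 L) t := by rw [sdwM_mul_sdwR_mul_sdwR hL t hΔ, Matrix.one_mul]
  rw [h, trace_hopMatrix, sub_zero]

/-- `tr (K' K R) = 0` (`S K' S = K'`, `S K S = -K`, `S R S = R`, cyclicity). [folklore] -/
theorem trace_diag_mul_hopMatrix_mul_sdwR (hL : 3 ≤ L) (hLe : Even L) (t' t : ℝ) {Δ : ℝ} (hΔ : Δ ≠ 0) :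
    (hopMatrix (fermionTorusDiagGraph L) t' * hopMatrix (fermionTorusGraph 2 L) t * sdwR 2 L t Δ).trace = 0 := by
  have hRS := sdwR_mul_stagMatrix (d := 2) hL hLe t hΔ
  have hSKS := stagMatrix_mul_hopMatrix_mul_stagMatrix (d := 2) hLe t
  have hSK' := stagMatrix_mul_hopMatrix_diag (L := L) hLe t'
  set S := stagMatrix 2 L
  set K := hopMatrix (fermionTorusGraph 2 L) t
  set K' := hopMatrix (fermionTorusDiagGraph L) t'
  set R := sdwR 2 L t Δ
  have hSS : S * S = 1 := stagMatrix_mul_self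
  have hX : S * (K' * K * R) * S = -(K' * K * R) := by
    calc S * (K' * K * R) * S = (S * K') * K * (R * S) := by simp only [Matrix.mul_assoc]
      _ = (K' * S) * K * (S * R) := by rw [hSK', hRS]
      _ = K' * (S * K * S) * R := by simp only [Matrix.mul_assoc]
      _ = -(K' * K * R) := by rw [hSKS]; simp only [Matrix.mul_neg, Matrix.neg_mul, Matrix.mul_assoc]
  have htr : (K' * K * R).trace = -(K' * K * R).trace := by
    calc (K' * K * R).trace = (S * S * (K' * K * R)).trace := by rw [hSS, Matrix.one_mul]
      _ = (S * (S * (K' * K * R))).trace := by rw [Matrix.mul_assoc]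
      _ = (S * (K' * K * R) * S).trace := by rw [trace_mul_comm]
      _ = -(K' * K * R).trace := by rw [hX, trace_neg]
  have h2 : (2 : ℂ) * (K' * K * R).trace = 0 := by linear_combination htr
  exact (mul_eq_zero.mp h2).resolve_left two_ne_zero

/-- `tr (K' (P_+ + P_-)) = 0`: the diagonal-bond energy of the two filled SDW bands vanishes.
[folklore] -/
theorem trace_diag_mul_sdwProj_add (hL : 3 ≤ L) (hLe : Even L) (t' t : ℝ) {Δ : ℝ} (hΔ : Δ ≠ 0) :
    (hopMatrix (fermionTorusDiagGraph L) t' * (sdwProj 2 L t Δ 1 + sdwProj 2 L t Δ (-1))).trace = 0 := by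
  rw [sdwProj_add_sdwProj, Matrix.mul_sub, Matrix.mul_one, trace_sub, trace_hopMatrix_diag,
    ← Matrix.mul_assoc, trace_diag_mul_hopMatrix_mul_sdwR hL hLe t' t hΔ, sub_zero]

/-- `Σ_k ε_k² = tr K² = 4t²L²` on `(ℤ/Lℤ)²`, `L ≥ 3` (each site has four neighbours).
[cite: FriedliVelenik2017, §3.1] -/
theorem sum_siteBand_sq (hL : 3 ≤ L) (t : ℝ) :
    ∑ k : FermionTorus 2 L, siteBand t k ^ 2 = 4 * t ^ 2 * (L : ℝ) ^ 2 := by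
  classical
  -- the trace of `K²` in momentum space
  have h1 : (hopMatrix (fermionTorusGraph 2 L) t * hopMatrix (fermionTorusGraph 2 L) t).trace =
      ∑ k : FermionTorus 2 L, (((siteBand t k ^ 2 : ℝ)) : ℂ) := by
    rw [hopMatrix_eq_conjDiag hL, conjDiag_mul, trace_conjDiag]
    refine Finset.sum_congr rfl fun k _ => ?_
    simp only [Pi.mul_apply]; push_cast; ring
  -- the trace of `K²` in position space
  have h2 : (hopMatrix (fermionTorusGraph 2 L) t * hopMatrix (fermionTorusGraph 2 L) t).trace =
      ((4 * t ^ 2 * (L : ℝ) ^ 2 : ℝ) : ℂ) := by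
    rw [Matrix.trace]
    simp only [Matrix.diag_apply, Matrix.mul_apply]
    have hx : ∀ x : FermionTorus 2 L, ∑ y, hopMatrix (fermionTorusGraph 2 L) t x y *
        hopMatrix (fermionTorusGraph 2 L) t y x = ((4 * t ^ 2 : ℝ) : ℂ) := by
      intro x
      have hxy : ∀ y, hopMatrix (fermionTorusGraph 2 L) t x y * hopMatrix (fermionTorusGraph 2 L) t y x =
          if (fermionTorusGraph 2 L).Adj x y then ((t ^ 2 : ℝ) : ℂ) else 0 := by
        intro y
        simp only [hopMatrix, Matrix.of_apply, (fermionTorusGraph 2 L).adj_comm y x]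
        split_ifs <;> push_cast <;> ring
      simp_rw [hxy]
      rw [Finset.sum_ite, Finset.sum_const_zero, add_zero, Finset.sum_const,
        card_filter_fermionTorusGraph_adj hL x]
      push_cast; ring
    simp_rw [hx]
    rw [Finset.sum_const, Finset.card_univ, card_fermionTorus_eq]
    push_cast; ring
  have h := h1.symm.trans h2
  rw [← Complex.ofReal_inj]
  push_cast at h ⊢
  rw [← h]

/-- **`tr E ≤ L²√(4t² + Δ²)`** (Cauchy–Schwarz: `Σ_k E_k ≤ √(L² Σ_k E_k²)`, `Σ_k E_k² = 4t²L² + Δ²L²`).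
[cite: LiebLoss1993, §8] -/
theorem sum_sdwE_le (hL : 3 ≤ L) (t Δ : ℝ) :
    ∑ k : FermionTorus 2 L, sdwE t Δ k ≤ (L : ℝ) ^ 2 * Real.sqrt (4 * t ^ 2 + Δ ^ 2) := by
  classical
  have hcard : (Finset.univ : Finset (FermionTorus 2 L)).card = L ^ 2 := by
    rw [Finset.card_univ, card_fermionTorus_eq]
  have hsq : ∑ k : FermionTorus 2 L, sdwE t Δ k ^ 2 = (4 * t ^ 2 + Δ ^ 2) * (L : ℝ) ^ 2 := by
    simp only [sdwE_sq, Finset.sum_add_distrib, Finset.sum_const, hcard]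
    rw [sum_siteBand_sq hL]
    ring
  have hCS := Finset.sum_mul_sq_le_sq_mul_sq (Finset.univ : Finset (FermionTorus 2 L))
    (fun _ => (1 : ℝ)) (fun k => sdwE t Δ k)
  simp only [one_mul, one_pow, Finset.sum_const, hcard, nsmul_eq_mul, mul_one] at hCS
  rw [hsq] at hCS
  have hnn : 0 ≤ ∑ k : FermionTorus 2 L, sdwE t Δ k :=
    Finset.sum_nonneg fun k _ => Real.sqrt_nonneg _
  have hL0 : (0 : ℝ) ≤ (L : ℝ) ^ 2 := by positivity
  have htarget : ((L : ℝ) ^ 2 * Real.sqrt (4 * t ^ 2 + Δ ^ 2)) ^ 2 = (L : ℝ) ^ 2 * ((4 * t ^ 2 + Δ ^ 2) * (L : ℝ) ^ 2) := by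
    rw [mul_pow, Real.sq_sqrt (by positivity)]; ring
  have hle : (∑ k : FermionTorus 2 L, sdwE t Δ k) ^ 2 ≤ ((L : ℝ) ^ 2 * Real.sqrt (4 * t ^ 2 + Δ ^ 2)) ^ 2 := by
    rw [htarget]; exact_mod_cast hCS
  have hy : 0 ≤ (L : ℝ) ^ 2 * Real.sqrt (4 * t ^ 2 + Δ ^ 2) := by positivity
  calc ∑ k : FermionTorus 2 L, sdwE t Δ k = Real.sqrt ((∑ k : FermionTorus 2 L, sdwE t Δ k) ^ 2) :=
        (Real.sqrt_sq hnn).symm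
    _ ≤ Real.sqrt (((L : ℝ) ^ 2 * Real.sqrt (4 * t ^ 2 + Δ ^ 2)) ^ 2) := Real.sqrt_le_sqrt hle
    _ = (L : ℝ) ^ 2 * Real.sqrt (4 * t ^ 2 + Δ ^ 2) := Real.sqrt_sq hy

end Traces

/-! ### §4 Three one-body inequalities on Fock space -/

section Fock

variable {Λ : Type*} [LinearOrder Λ] [Fintype Λ]

/-- `dΓ_σ(C) ⪰ 0` for `C ⪰ 0`: `0 ≤ Re⟨φ, dΓ_σ(C)φ⟩`. [cite: LiebLoss1993, §8, proof of Theorem 8.2] -/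
theorem re_expect_dGammaSpin_nonneg (σ : Fin 2) {C : Matrix Λ Λ ℂ} (hC : C.PosSemidef)
    (φ : Fock (Orb Λ)) : 0 ≤ (star φ ⬝ᵥ (dGammaSpin σ C *ᵥ φ)).re := by
  classical
  have h := sum_min_eigenvalues_mul_normSq_le σ hC.1 φ
  have h0 : ∑ i, min (hC.1.eigenvalues i) 0 = 0 :=
    Finset.sum_eq_zero fun i _ => min_eq_right (hC.eigenvalues_nonneg i)
  rw [h0, zero_mul] at h
  exact h

/-- `dΓ_σ(C) ≤ tr C` for `C ⪰ 0`: `Re⟨φ, dΓ_σ(C)φ⟩ ≤ (tr C)‖φ‖²` (each rotated occupation is at most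
`‖φ‖²`). [cite: LiebLoss1993, §8, proof of Theorem 8.2] -/
theorem re_expect_dGammaSpin_le_trace_mul_normSq (σ : Fin 2) {C : Matrix Λ Λ ℂ} (hC : C.PosSemidef)
    (φ : Fock (Orb Λ)) : (star φ ⬝ᵥ (dGammaSpin σ C *ᵥ φ)).re ≤ C.trace.re * normSq φ := by
  classical
  have hA : C.IsHermitian := hC.1
  set V : Matrix Λ Λ ℂ := (hA.eigenvectorUnitary : Matrix Λ Λ ℂ) with hVdef
  have hVV : V * star V = 1 := Matrix.mem_unitaryGroup_iff.1 hA.eigenvectorUnitary.2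
  have hVV' : star V * V = 1 := Matrix.mem_unitaryGroup_iff'.1 hA.eigenvectorUnitary.2
  set v : Λ → Λ → ℂ := fun k x => V x k with hvdef
  have hv : ∀ x y : Λ, ∑ k, v k x * star (v k y) = if x = y then 1 else 0 := fun x y => by
    have h := congrFun (congrFun hVV x) y
    simp only [Matrix.mul_apply, Matrix.star_apply, Matrix.one_apply] at h
    exact h
  have hon : ∀ k l, star (v k) ⬝ᵥ v l = if k = l then 1 else 0 := fun k l => by
    have h := congrFun (congrFun hVV' k) l
    simp only [Matrix.mul_apply, Matrix.star_apply, Matrix.one_apply] at h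
    rw [dotProduct]
    simpa only [Pi.star_apply] using h
  have heig : ∀ k, C *ᵥ v k = ((hA.eigenvalues k : ℝ) : ℂ) • v k := fun k => by
    have hcol : v k = ⇑(hA.eigenvectorBasis k) := by
      funext x
      show V x k = _
      rw [hVdef, Matrix.IsHermitian.eigenvectorUnitary_apply]
    rw [hcol, hA.mulVec_eigenvectorBasis k]
    funext x
    simp only [Pi.smul_apply, Complex.real_smul, smul_eq_mul]
  set w : Λ × Fin 2 → Orb Λ → ℂ := fun p o => if (ofLex o).2 = p.2 then v p.1 (ofLex o).1 else 0
    with hwdef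
  have hw : ∀ p o, w p o = if (ofLex o).2 = p.2 then v p.1 (ofLex o).1 else 0 := fun p o => rfl
  rw [re_rayleigh_dGammaSpin_eq_sum σ C v hA.eigenvalues hv heig w hw φ]
  have htr : C.trace.re = ∑ k, hA.eigenvalues k := by
    rw [hA.trace_eq_sum_eigenvalues, Complex.re_sum]
    simp
  rw [htr, Finset.sum_mul]
  refine Finset.sum_le_sum fun k _ => ?_
  have h0 : 0 ≤ hA.eigenvalues k := hC.eigenvalues_nonneg k
  have h1 : normSq (annihilate (w (k, σ)) *ᵥ φ) ≤ normSq φ :=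
    normSq_annihilate_mulVec_le (spinMode_unit v hon w hw (k, σ)) φ
  exact mul_le_mul_of_nonneg_left h1 h0

/-- `dΓ_σ(P) ≤ N_σ` for `P ≤ 1`: `Re⟨φ, dΓ_σ(P)φ⟩ ≤ Re⟨φ, N_σ φ⟩`. [cite: LiebLoss1993, §8] -/
theorem re_expect_dGammaSpin_le_number (σ : Fin 2) {P : Matrix Λ Λ ℂ} (hP : (1 - P).PosSemidef)
    (φ : Fock (Orb Λ)) :
    (star φ ⬝ᵥ (dGammaSpin σ P *ᵥ φ)).re ≤ (star φ ⬝ᵥ ((∑ x : Λ, numberOp x σ) *ᵥ φ)).re := by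
  have h := re_expect_dGammaSpin_nonneg σ hP φ
  have hsplit : dGammaSpin σ (1 - P) = (∑ x : Λ, numberOp x σ) - dGammaSpin σ P := by
    rw [← dGammaSpin_one σ, eq_sub_iff_add_eq, ← dGammaSpin_add, sub_add_cancel]
  rw [hsplit, Matrix.sub_mulVec, dotProduct_sub, Complex.sub_re] at h
  linarith

end Fock

/-! ### §4b The staggered magnetisation is at most half the density -/

section Stagger

variable [NeZero L]

omit [NeZero L] in
/-- **`|Re⟨φ, Ôφ⟩| ≤ Re⟨φ, N̂φ⟩`**: twice the staggered magnetisation is at most the particle number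
(`-1 ≤ S ≤ 1`, so `±dΓ_σ(S) ≤ N̂_σ`). [cite: LiebPRL1989, Theorem 2 (bipartite lattice)] -/
theorem abs_re_expect_stag_le_number (φ : Fock (Orb (FermionTorus 2 L))) :
    |(star φ ⬝ᵥ ((dGammaSpin 0 (stagMatrix 2 L) - dGammaSpin 1 (stagMatrix 2 L)) *ᵥ φ)).re| ≤
      (star φ ⬝ᵥ (totalNumber *ᵥ φ)).re := by
  classical
  -- the staggering signs are `±1`
  have hsign : ∀ x : FermionTorus 2 L,
      (((torusStagger x : ℤˣ) : ℤ) : ℂ) = 1 ∨ (((torusStagger x : ℤˣ) : ℤ) : ℂ) = -1 := by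
    intro x
    rcases Int.units_eq_one_or (torusStagger x) with h | h
    · left; rw [h]; simp
    · right; rw [h]; simp
  -- `1 ∓ S ⪰ 0`
  have hpsd : ∀ ε : ℂ, (ε = 1 ∨ ε = -1) →
      ((1 : Matrix (FermionTorus 2 L) (FermionTorus 2 L) ℂ) - ε • stagMatrix 2 L).PosSemidef := by
    intro ε hε
    have hdiag : (1 : Matrix (FermionTorus 2 L) (FermionTorus 2 L) ℂ) - ε • stagMatrix 2 L =
        diagonal (fun x => 1 - ε * (((torusStagger x : ℤˣ) : ℤ) : ℂ)) := by
      ext x y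
      rw [stagMatrix, Matrix.sub_apply, Matrix.smul_apply, Matrix.one_apply, diagonal_apply, diagonal_apply,
        smul_eq_mul]
      split_ifs <;> simp
    rw [hdiag, posSemidef_diagonal_iff]
    intro x
    rcases hε with rfl | rfl <;> rcases hsign x with h | h <;> rw [h] <;> norm_num
  -- `±dΓ_σ(S) ≤ N̂_σ`
  have hle : ∀ (σ : Fin 2) (ε : ℂ), (ε = 1 ∨ ε = -1) →
      (star φ ⬝ᵥ (dGammaSpin σ (ε • stagMatrix 2 L) *ᵥ φ)).re ≤
        (star φ ⬝ᵥ ((∑ x : FermionTorus 2 L, numberOp x σ) *ᵥ φ)).re := by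
    intro σ ε hε
    have h1 := hpsd ε hε
    exact re_expect_dGammaSpin_le_number σ (P := ε • stagMatrix 2 L)
      (by convert h1 using 4; congr 1; exact Subsingleton.elim _ _) φ
  have h0p := hle 0 1 (Or.inl rfl)
  have h0m := hle 0 (-1) (Or.inr rfl)
  have h1p := hle 1 1 (Or.inl rfl)
  have h1m := hle 1 (-1) (Or.inr rfl)
  simp only [one_smul, dGammaSpin_smul, Matrix.smul_mulVec, dotProduct_smul, smul_eq_mul, neg_one_mul,
    Complex.neg_re] at h0p h0m h1p h1m
  rw [totalNumber_eq_add, Matrix.add_mulVec, dotProduct_add, Complex.add_re, Matrix.sub_mulVec, dotProduct_sub,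
    Complex.sub_re, abs_le]
  constructor <;> linarith

/-- Consequently, in the notation of the class floor (`Re⟨N̂⟩ = nL²‖φ‖²`, `Re⟨Ô⟩ = 2mL²‖φ‖²`, `φ ≠ 0`):
`2|m| ≤ n`. [cite: LiebPRL1989, Theorem 2 (bipartite lattice)] -/
theorem two_abs_stag_le_density {n m : ℝ} {φ : Fock (Orb (FermionTorus 2 L))} (hφ : φ ≠ 0)
    (hN : (star φ ⬝ᵥ (totalNumber *ᵥ φ)).re = n * (L : ℝ) ^ 2 * normSq φ)
    (hO : (star φ ⬝ᵥ ((dGammaSpin 0 (stagMatrix 2 L) - dGammaSpin 1 (stagMatrix 2 L)) *ᵥ φ)).re =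
      2 * m * (L : ℝ) ^ 2 * normSq φ) :
    2 * |m| ≤ n := by
  have h := abs_re_expect_stag_le_number φ
  rw [hN, hO] at h
  have hpos : 0 < normSq φ := by
    rcases (normSq_nonneg φ).lt_or_eq with hlt | heq
    · exact hlt
    · exact absurd (eq_zero_of_normSq_eq_zero heq.symm) hφ
  have hL0 : (0 : ℝ) < (L : ℝ) ^ 2 := by
    have hL1 : (0 : ℝ) < L := by
      have : 0 < L := Nat.pos_of_ne_zero (NeZero.ne L)
      exact_mod_cast this
    positivity
  have hprod : 0 < (L : ℝ) ^ 2 * normSq φ := mul_pos hL0 hpos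
  rw [show 2 * m * (L : ℝ) ^ 2 * normSq φ = (2 * m) * ((L : ℝ) ^ 2 * normSq φ) by ring, abs_mul,
    abs_of_pos hprod, show n * (L : ℝ) ^ 2 * normSq φ = n * ((L : ℝ) ^ 2 * normSq φ) by ring] at h
  rw [show 2 * |m| = |2 * m| by rw [abs_mul, abs_of_pos (by norm_num : (0:ℝ) < 2)]]
  exact le_of_mul_le_mul_right h hprod

end Stagger

end NeelClassFloor

end Summit.Ventures.CertifiedManyBodySolver.Observables

end
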